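import Mathlib.Algebra.Order.BigOperators.Group.Finset
import Summits.QuantumAdvantage.QuantumAdvantage.Theorems.CubicForrelationNearExactIsExactInvariantWeight

/-!
# Crux `CubicForrelation.NearExactIsExact` (stmt-QuantumAdvantage-14043) — the RADICAL COUNT of a maximal symplectic frame
  (the rank of an alternating form over `𝔽₂` is well defined), on any number of bits; halving tools

Certificate seat `b2b-cforr-cert` (gen 41).  HONEST FRAMING: kernel-checked elementary counting (standard axioms, Mathlib + the tree's
bit-vector language only) — one of the generic tools listed as still missing in the Lean roadmap for `E1280-even`
(HOME/b2b-cforr-cert-g40/LEAN-PLAN-E1280-EVEN.md §4–5, "rank well-definedness"; the companion "Dickson EXACTNESS" is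
…CubicFormDicksonExact, which imports this file).  The cell lemmas of the light-cell analysis (HOME/b2b-cforr-cert-g39/E1280-HANDPROOFS.md
App. A) compare ranks of the alternating parts of different cells, which needs the rank — `h` of a MAXIMAL frame as produced by
…CubicFormSymplectic `tcs_frame_exists` — to be frame-independent.  Nothing about `θ₁₂`; NOT summit progress.

Language: `B : 𝔽₂ⁿ × 𝔽₂ⁿ → Bool` symmetric and additive in the first slot; a frame `(bᵢ, cᵢ)_{i<h}` with `B(bᵢ,cⱼ) = [i = j]`,
`B(bᵢ,bⱼ) = 0`, MAXIMAL in the sense of `tcs_frame_exists` (`B` vanishes on pairs of frame-orthogonal vectors).  `B(cᵢ,cⱼ) = 0` and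
`B(x,x) = 0` are never used.

* `tce_half`: a translation preserving `S` and flipping a predicate on `S` halves `S`.
* `tce_iter_half`: `h` commuting such conditions cut `S` down by `2^h`.
* `tce_affine_dichotomy`: a `⊕`-affine predicate on a set closed under `x ⊕ y ⊕ z` holds on none, half, or all of it.
* `tce_form_vanish`: `B(x,y) = 0` whenever `x, y` are `B`-orthogonal to all `bᵢ` (maximality + descent along the `bⱼ`).
* `tce_radical_of_orth`: a frame-orthogonal vector is in the radical of `B`.
* `tce_radical_card` (**rank is well defined**): `2h ≤ n` and `#Rad B = 2^{n − 2h}`; `tce_frame_size_unique`: two maximal frames have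
  the same size.

References: L. E. Dickson, *Linear Groups* (1901) Ch. VIII; F. J. MacWilliams, N. J. A. Sloane (1977) Ch. 15 §2 Thm 4.
Axioms: the standard three.
-/

set_option linter.dupNamespace false -- D-0017: single-problem summit ⇒ `QuantumAdvantage.QuantumAdvantage` by design

namespace Summit.QuantumAdvantage.QuantumAdvantage.Theorems.CubicForrelation.NearExactIsExact

open Finset
open Literature.Computability.QuantumComplexity.BuzetChailloux (bxor zeroVec bxor_comm bxor_self bxor_zeroVec zeroVec_bxor
  bxor_bxor_cancel_left)

variable {n : ℕ}

/-! ### Halving by translations -/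

/-- **Halving.**  If translation by `t` preserves `S` and flips the predicate `P` on `S`, then `P` holds on exactly half of `S`.
[folklore] -/
theorem tce_half (S : Finset (Fin n → Bool)) (t : Fin n → Bool) (P : (Fin n → Bool) → Bool)
    (hS : ∀ x ∈ S, bxor x t ∈ S) (hP : ∀ x ∈ S, P (bxor x t) = !P x) :
    2 * #(S.filter fun x => P x = true) = #S ∧ 2 * #(S.filter fun x => P x = false) = #S := by
  classical
  have hcancel : ∀ x : Fin n → Bool, bxor (bxor x t) t = x := fun x => by
    rw [iw_bxor_assoc, bxor_self, bxor_zeroVec]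
  have himg : (S.filter fun x => P x = false) = (S.filter fun x => P x = true).image (fun x => bxor x t) := by
    ext y
    simp only [mem_filter, mem_image]
    constructor
    · rintro ⟨hyS, hPy⟩
      refine ⟨bxor y t, ⟨hS y hyS, ?_⟩, hcancel y⟩
      rw [hP y hyS, hPy]; rfl
    · rintro ⟨x, ⟨hxS, hPx⟩, rfl⟩
      refine ⟨hS x hxS, ?_⟩
      rw [hP x hxS, hPx]; rfl
  have hinj : Function.Injective (fun x : Fin n → Bool => bxor x t) := fun x y hxy => by
    have e := congrArg (fun z : Fin n → Bool => bxor z t) hxy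
    simp only [hcancel] at e
    exact e
  have hsplit := card_filter_add_card_filter_not (s := S) (fun x => P x = true)
  have hneg : (S.filter fun x => ¬ P x = true) = (S.filter fun x => P x = false) :=
    filter_congr fun x _ => by cases P x <;> simp
  rw [hneg, himg, card_image_of_injective _ hinj] at hsplit
  have h2 : #(S.filter fun x => P x = false) = #(S.filter fun x => P x = true) := by
    rw [himg, card_image_of_injective _ hinj]
  omega

/-- **Iterated halving.**  `h` conditions `Pᵢ = 0` on `S`, with translations `tₖ` preserving `S`, flipping `Pₖ` and keeping the other
`Pᵢ`, cut `S` down by the factor `2^h`. [folklore] -/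
theorem tce_iter_half (S : Finset (Fin n → Bool)) {h : ℕ} (P : Fin h → (Fin n → Bool) → Bool) (t : Fin h → (Fin n → Bool))
    (hS : ∀ k, ∀ x ∈ S, bxor x (t k) ∈ S) (hflip : ∀ k, ∀ x ∈ S, P k (bxor x (t k)) = !P k x)
    (hkeep : ∀ k i, i ≠ k → ∀ x ∈ S, P i (bxor x (t k)) = P i x) :
    #(S.filter fun x => ∀ i, P i x = false) * 2 ^ h = #S := by
  classical
  set Z : ℕ → Finset (Fin n → Bool) := fun k => S.filter fun x => ∀ i : Fin h, i.val < k → P i x = false with hZdef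
  have key : ∀ k, k ≤ h → #(Z k) * 2 ^ k = #S := by
    intro k
    induction k with
    | zero =>
      intro _
      have hZ0 : Z 0 = S := by
        rw [hZdef]; ext x; simp
      rw [hZ0, pow_zero, mul_one]
    | succ k ih =>
      intro hk
      have ihk := ih (Nat.le_of_succ_le hk)
      have hkh : k < h := hk
      set i₀ : Fin h := ⟨k, hkh⟩ with hi₀
      have hZsucc : Z (k + 1) = (Z k).filter fun x => P i₀ x = false := by
        rw [hZdef]; ext x
        simp only [mem_filter]
        constructor
        · rintro ⟨hxS, hx⟩
          exact ⟨⟨hxS, fun i hi => hx i (Nat.lt_succ_of_lt hi)⟩, hx i₀ (by rw [hi₀]; exact Nat.lt_succ_self k)⟩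
        · rintro ⟨⟨hxS, hx⟩, h0⟩
          refine ⟨hxS, fun i hi => ?_⟩
          rcases Nat.lt_succ_iff_lt_or_eq.1 hi with hlt | heq
          · exact hx i hlt
          · have : i = i₀ := Fin.ext (by rw [hi₀]; exact heq)
            rw [this]; exact h0
      have hZS : ∀ x ∈ Z k, x ∈ S := fun x hx => (mem_filter.1 hx).1
      have harith : ∀ a s : ℕ, 2 * a = #(Z k) → #(Z k) * 2 ^ k = s → a * 2 ^ (k + 1) = s := by
        intro a s h1 h2; rw [← h2, ← h1]; ring
      have hpres : ∀ x ∈ Z k, bxor x (t i₀) ∈ Z k := by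
        intro x hx
        obtain ⟨hxS, hxP⟩ := mem_filter.1 hx
        refine mem_filter.2 ⟨hS i₀ x hxS, fun i hi => ?_⟩
        have hne : i ≠ i₀ := by
          intro heq; rw [heq, hi₀] at hi; exact lt_irrefl k hi
        rw [hkeep i₀ i hne x hxS]; exact hxP i hi
      obtain ⟨-, hhalf⟩ := tce_half (Z k) (t i₀) (P i₀) hpres (fun x hx => hflip i₀ x (hZS x hx))
      rw [hZsucc]; exact harith _ _ hhalf ihk
  have hZh : Z h = S.filter fun x => ∀ i, P i x = false := by
    rw [hZdef]; ext x
    simp only [mem_filter]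
    exact ⟨fun ⟨hxS, hx⟩ => ⟨hxS, fun i => hx i i.isLt⟩, fun ⟨hxS, hx⟩ => ⟨hxS, fun i _ => hx i⟩⟩
  rw [← hZh]; exact key h le_rfl

/-- **Affine dichotomy.**  On a set `S` closed under `x ⊕ y ⊕ z`, a predicate with `f(x ⊕ y ⊕ z) = f x ⊕ f y ⊕ f z` holds on no element,
on exactly half of them, or on all of them. [folklore] -/
theorem tce_affine_dichotomy (S : Finset (Fin n → Bool)) (f : (Fin n → Bool) → Bool)
    (hS : ∀ x ∈ S, ∀ y ∈ S, ∀ z ∈ S, bxor x (bxor y z) ∈ S)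
    (hf : ∀ x ∈ S, ∀ y ∈ S, ∀ z ∈ S, f (bxor x (bxor y z)) = ((f x ^^ f y) ^^ f z)) :
    #(S.filter fun x => f x = true) = 0 ∨ 2 * #(S.filter fun x => f x = true) = #S ∨ #(S.filter fun x => f x = true) = #S := by
  classical
  by_cases hne : ∃ x₀ ∈ S, ∃ x₁ ∈ S, f x₀ ≠ f x₁
  · obtain ⟨x₀, hx₀, x₁, hx₁, h01⟩ := hne
    refine Or.inr (Or.inl (tce_half S (bxor x₀ x₁) f (fun x hx => hS x hx x₀ hx₀ x₁ hx₁) fun x hx => ?_).1)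
    rw [hf x hx x₀ hx₀ x₁ hx₁]
    revert h01
    cases f x <;> cases f x₀ <;> cases f x₁ <;> decide
  · push Not at hne
    rcases S.eq_empty_or_nonempty with hS0 | ⟨x₀, hx₀⟩
    · left; rw [hS0]; rfl
    · cases hf0 : f x₀
      · left
        rw [card_eq_zero, filter_eq_empty_iff]
        intro x hx hfx
        rw [hne x hx x₀ hx₀, hf0] at hfx
        exact Bool.false_ne_true hfx
      · right; right
        rw [filter_true_of_mem fun x hx => by rw [hne x hx x₀ hx₀, hf0]]

/-! ### Maximal frames: the radical -/

section Frame

variable (B : (Fin n → Bool) → (Fin n → Bool) → Bool) (hsymm : ∀ x y, B x y = B y x)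
  (hadd : ∀ x y z, B (bxor x y) z = (B x z ^^ B y z))
  (h : ℕ) (b c : Fin h → (Fin n → Bool))
  (hbc : ∀ i, B (b i) (c i) = true) (hbc' : ∀ i j, i ≠ j → B (b i) (c j) = false) (hbb : ∀ i j, B (b i) (b j) = false)
  (hmax : ∀ x y, (∀ i, B x (b i) = false) → (∀ i, B x (c i) = false) → (∀ i, B y (b i) = false) → (∀ i, B y (c i) = false) →
    B x y = false)
include hsymm hadd hbc hbc' hbb hmax

/-- **`B` vanishes on `{B(·,bᵢ) = 0 ∀ i}`** (which is the frame-orthogonal set plus the span of the `bᵢ`): descent along the `bⱼ`,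
ending in maximality. [folklore; cite: MacWilliamsSloane1977, Ch. 15 §2] -/
theorem tce_form_vanish (x y : Fin n → Bool) (hx : ∀ i, B x (b i) = false) (hy : ∀ i, B y (b i) = false) : B x y = false := by
  classical
  -- one descent step in the first argument
  have step : ∀ (m : ℕ) (x y : Fin n → Bool), (∀ i, B x (b i) = false) → (∀ i, B y (b i) = false) →
      #(univ.filter fun j => B x (c j) = true) ≤ m → (∀ j, B y (c j) = false) → B x y = false := by
    intro m
    induction m with
    | zero =>
      intro x y hx hy hm hyc
      have hxc : ∀ j, B x (c j) = false := fun j => by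
        by_contra hcj
        rw [Bool.not_eq_false] at hcj
        have : 0 < #(univ.filter fun j => B x (c j) = true) := card_pos.2 ⟨j, mem_filter.2 ⟨mem_univ _, hcj⟩⟩
        omega
      exact hmax x y hx hxc hy hyc
    | succ m ih =>
      intro x y hx hy hm hyc
      by_cases hex : ∃ j, B x (c j) = true
      · obtain ⟨j, hj⟩ := hex
        have hx' : ∀ i, B (bxor x (b j)) (b i) = false := fun i => by rw [hadd, hx i, hbb j i]; rfl
        have hfilt : (univ.filter fun i => B (bxor x (b j)) (c i) = true) = (univ.filter fun i => B x (c i) = true).erase j := by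
          ext i
          simp only [mem_filter, mem_univ, true_and, mem_erase]
          rw [hadd]
          by_cases hij : i = j
          · rw [hij, hj, hbc j]; simp
          · rw [hbc' j i (fun e => hij e.symm), Bool.xor_false]
            exact ⟨fun h1 => ⟨hij, h1⟩, fun h1 => h1.2⟩
        have hjmem : j ∈ (univ.filter fun i => B x (c i) = true) := mem_filter.2 ⟨mem_univ _, hj⟩
        have hm' : #(univ.filter fun i => B (bxor x (b j)) (c i) = true) ≤ m := by
          rw [hfilt, card_erase_of_mem hjmem]; omega
        have e := ih (bxor x (b j)) y hx' hy hm' hyc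
        have hsplit : B x y = (B (bxor x (b j)) y ^^ B (b j) y) := by
          have := hadd (bxor x (b j)) (b j) y
          rw [iw_bxor_assoc, bxor_self, bxor_zeroVec] at this
          exact this
        rw [hsplit, e, hsymm, hy j]; rfl
      · push Not at hex
        have hxc : ∀ j, B x (c j) = false := fun j => by simpa using hex j
        exact hmax x y hx hxc hy hyc
  -- descent in the second argument, then the first
  have step2 : ∀ (m : ℕ) (x y : Fin n → Bool), (∀ i, B x (b i) = false) → (∀ i, B y (b i) = false) →
      #(univ.filter fun j => B y (c j) = true) ≤ m → B x y = false := by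
    intro m
    induction m with
    | zero =>
      intro x y hx hy hm
      have hyc : ∀ j, B y (c j) = false := fun j => by
        by_contra hcj
        rw [Bool.not_eq_false] at hcj
        have : 0 < #(univ.filter fun j => B y (c j) = true) := card_pos.2 ⟨j, mem_filter.2 ⟨mem_univ _, hcj⟩⟩
        omega
      exact step _ x y hx hy le_rfl hyc
    | succ m ih =>
      intro x y hx hy hm
      by_cases hex : ∃ j, B y (c j) = true
      · obtain ⟨j, hj⟩ := hex
        have hy' : ∀ i, B (bxor y (b j)) (b i) = false := fun i => by rw [hadd, hy i, hbb j i]; rfl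
        have hfilt : (univ.filter fun i => B (bxor y (b j)) (c i) = true) = (univ.filter fun i => B y (c i) = true).erase j := by
          ext i
          simp only [mem_filter, mem_univ, true_and, mem_erase]
          rw [hadd]
          by_cases hij : i = j
          · rw [hij, hj, hbc j]; simp
          · rw [hbc' j i (fun e => hij e.symm), Bool.xor_false]
            exact ⟨fun h1 => ⟨hij, h1⟩, fun h1 => h1.2⟩
        have hjmem : j ∈ (univ.filter fun i => B y (c i) = true) := mem_filter.2 ⟨mem_univ _, hj⟩
        have hm' : #(univ.filter fun i => B (bxor y (b j)) (c i) = true) ≤ m := by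
          rw [hfilt, card_erase_of_mem hjmem]; omega
        have e := ih x (bxor y (b j)) hx hy' hm'
        have hsplit : B x y = (B x (bxor y (b j)) ^^ B (b j) x) := by
          have := hadd (bxor y (b j)) (b j) x
          rw [iw_bxor_assoc, bxor_self, bxor_zeroVec] at this
          rw [hsymm x y, hsymm x (bxor y (b j))]
          exact this
        rw [hsplit, e, hsymm, hx j]; rfl
      · push Not at hex
        have hyc : ∀ j, B y (c j) = false := fun j => by simpa using hex j
        exact step _ x y hx hy le_rfl hyc
  exact step2 _ x y hx hy le_rfl

/-- **Frame-orthogonal vectors are radical vectors** (for a maximal frame). [folklore; cite: MacWilliamsSloane1977, Ch. 15 §2] -/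
theorem tce_radical_of_orth (x : Fin n → Bool) (hxb : ∀ i, B x (b i) = false) (hxc : ∀ i, B x (c i) = false) (y : Fin n → Bool) :
    B x y = false := by
  classical
  -- descent on the number of `i` with `B(y, bᵢ) = 1`, translating `y` by `cᵢ`
  have step : ∀ (m : ℕ) (y : Fin n → Bool), #(univ.filter fun i => B y (b i) = true) ≤ m → B x y = false := by
    intro m
    induction m with
    | zero =>
      intro y hm
      have hyb : ∀ i, B y (b i) = false := fun i => by
        by_contra hci
        rw [Bool.not_eq_false] at hci
        have : 0 < #(univ.filter fun i => B y (b i) = true) := card_pos.2 ⟨i, mem_filter.2 ⟨mem_univ _, hci⟩⟩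
        omega
      exact tce_form_vanish B hsymm hadd h b c hbc hbc' hbb hmax x y hxb hyb
    | succ m ih =>
      intro y hm
      by_cases hex : ∃ i, B y (b i) = true
      · obtain ⟨i, hi⟩ := hex
        have hfilt : (univ.filter fun j => B (bxor y (c i)) (b j) = true) = (univ.filter fun j => B y (b j) = true).erase i := by
          ext j
          simp only [mem_filter, mem_univ, true_and, mem_erase]
          rw [hadd, hsymm (c i) (b j)]
          by_cases hji : j = i
          · rw [hji, hi, hbc i]; simp
          · rw [hbc' j i hji, Bool.xor_false]
            exact ⟨fun h1 => ⟨hji, h1⟩, fun h1 => h1.2⟩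
        have himem : i ∈ (univ.filter fun j => B y (b j) = true) := mem_filter.2 ⟨mem_univ _, hi⟩
        have hm' : #(univ.filter fun j => B (bxor y (c i)) (b j) = true) ≤ m := by
          rw [hfilt, card_erase_of_mem himem]; omega
        have e := ih (bxor y (c i)) hm'
        have hsplit : B x y = (B x (bxor y (c i)) ^^ B (c i) x) := by
          have := hadd (bxor y (c i)) (c i) x
          rw [iw_bxor_assoc, bxor_self, bxor_zeroVec] at this
          rw [hsymm x y, hsymm x (bxor y (c i))]
          exact this
        rw [hsplit, e, hsymm, hxc i]; rfl
      · push Not at hex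
        have hyb : ∀ i, B y (b i) = false := fun i => by simpa using hex i
        exact tce_form_vanish B hsymm hadd h b c hbc hbc' hbb hmax x y hxb hyb
  exact step _ y le_rfl

/-- **The rank is well defined: the radical of `B` has exactly `2^{n − 2h}` elements** (and `2h ≤ n`) for any maximal frame of size
`h`.  The radical is the frame-orthogonal set, which is cut out of `𝔽₂ⁿ` by `2h` conditions, each halving (translate by `cₖ`, resp.
`bₖ`). [cite: MacWilliamsSloane1977, Ch. 15 §2 Thm 4] -/
theorem tce_radical_card :
    2 * h ≤ n ∧ #(univ.filter fun x : Fin n → Bool => ∀ y, B x y = false) = 2 ^ (n - 2 * h) := by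
  classical
  -- the radical is the frame-orthogonal set
  have hRO : (univ.filter fun x : Fin n → Bool => ∀ y, B x y = false) =
      (univ.filter fun x : Fin n → Bool => ∀ i, B x (b i) = false).filter fun x => ∀ i, B x (c i) = false := by
    ext x
    simp only [mem_filter, mem_univ, true_and]
    exact ⟨fun hx => ⟨fun i => hx _, fun i => hx _⟩,
      fun hx => fun y => tce_radical_of_orth B hsymm hadd h b c hbc hbc' hbb hmax x hx.1 hx.2 y⟩
  -- first the `b`-conditions (translations by `cₖ`)
  have hV : #(univ.filter fun x : Fin n → Bool => ∀ i, B x (b i) = false) * 2 ^ h = 2 ^ n := by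
    have e := tce_iter_half (univ : Finset (Fin n → Bool)) (fun i x => B x (b i)) c (fun k x _ => mem_univ _)
      (fun k x _ => by show B (bxor x (c k)) (b k) = !B x (b k); rw [hadd, hsymm (c k) (b k), hbc k, Bool.xor_true])
      (fun k i hik x _ => by
        show B (bxor x (c k)) (b i) = B x (b i); rw [hadd, hsymm (c k) (b i), hbc' i k hik, Bool.xor_false])
    rw [card_univ, Fintype.card_fun, Fintype.card_bool, Fintype.card_fin] at e
    exact e
  -- then the `c`-conditions inside (translations by `bₖ`)
  have hW : #((univ.filter fun x : Fin n → Bool => ∀ i, B x (b i) = false).filter fun x => ∀ i, B x (c i) = false) * 2 ^ h =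
      #(univ.filter fun x : Fin n → Bool => ∀ i, B x (b i) = false) := by
    refine tce_iter_half _ (fun i x => B x (c i)) b (fun k x hx => ?_) (fun k x _ => ?_) (fun k i hik x _ => ?_)
    · have hx' := (mem_filter.1 hx).2
      refine mem_filter.2 ⟨mem_univ _, fun i => ?_⟩
      rw [hadd, hx' i, hbb k i]; rfl
    · show B (bxor x (b k)) (c k) = !B x (c k)
      rw [hadd, hbc k, Bool.xor_true]
    · show B (bxor x (b k)) (c i) = B x (c i)
      rw [hadd, hbc' k i (fun e => hik e.symm), Bool.xor_false]
  have htot : #(univ.filter fun x : Fin n → Bool => ∀ y, B x y = false) * 2 ^ (2 * h) = 2 ^ n := by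
    rw [hRO, ← hV, ← hW, two_mul, pow_add, mul_assoc]
  have hpos : 0 < #(univ.filter fun x : Fin n → Bool => ∀ y, B x y = false) := by
    rcases Nat.eq_zero_or_pos #(univ.filter fun x : Fin n → Bool => ∀ y, B x y = false) with h0 | hp
    · rw [h0, zero_mul] at htot; exact absurd htot (by positivity)
    · exact hp
  have hle : 2 * h ≤ n := by
    by_contra hlt
    rw [not_le] at hlt
    have h1 : 2 ^ n < 2 ^ (2 * h) := Nat.pow_lt_pow_right (by norm_num) hlt
    have h2 : 2 ^ (2 * h) ≤ #(univ.filter fun x : Fin n → Bool => ∀ y, B x y = false) * 2 ^ (2 * h) :=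
      Nat.le_mul_of_pos_left _ hpos
    omega
  refine ⟨hle, ?_⟩
  have hnh : 2 ^ (n - 2 * h) * 2 ^ (2 * h) = 2 ^ n := by rw [← pow_add, Nat.sub_add_cancel hle]
  exact Nat.eq_of_mul_eq_mul_right (by positivity) (htot.trans hnh.symm)

end Frame

/-- **Two maximal frames of the same form have the same size** (`h = rank/2`). [cite: MacWilliamsSloane1977, Ch. 15 §2 Thm 4] -/
theorem tce_frame_size_unique (B : (Fin n → Bool) → (Fin n → Bool) → Bool) (hsymm : ∀ x y, B x y = B y x)
    (hadd : ∀ x y z, B (bxor x y) z = (B x z ^^ B y z))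
    (h : ℕ) (b c : Fin h → (Fin n → Bool))
    (hbc : ∀ i, B (b i) (c i) = true) (hbc' : ∀ i j, i ≠ j → B (b i) (c j) = false) (hbb : ∀ i j, B (b i) (b j) = false)
    (hmax : ∀ x y, (∀ i, B x (b i) = false) → (∀ i, B x (c i) = false) → (∀ i, B y (b i) = false) → (∀ i, B y (c i) = false) →
      B x y = false)
    (h' : ℕ) (b' c' : Fin h' → (Fin n → Bool))
    (hbc₂ : ∀ i, B (b' i) (c' i) = true) (hbc₂' : ∀ i j, i ≠ j → B (b' i) (c' j) = false) (hbb₂ : ∀ i j, B (b' i) (b' j) = false)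
    (hmax₂ : ∀ x y, (∀ i, B x (b' i) = false) → (∀ i, B x (c' i) = false) → (∀ i, B y (b' i) = false) →
      (∀ i, B y (c' i) = false) → B x y = false) :
    h = h' := by
  obtain ⟨h1, e1⟩ := tce_radical_card B hsymm hadd h b c hbc hbc' hbb hmax
  obtain ⟨h2, e2⟩ := tce_radical_card B hsymm hadd h' b' c' hbc₂ hbc₂' hbb₂ hmax₂
  rw [e1] at e2
  have := Nat.pow_right_injective le_rfl e2
  omega

end Summit.QuantumAdvantage.QuantumAdvantage.Theorems.CubicForrelation.NearExactIsExact
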